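import Literature.RepresentationTheory.KonnoKonno2007.U21KAKSectionGroup
import Mathlib.Analysis.SpecialFunctions.Sqrt
import Mathlib.Analysis.InnerProductSpace.Calculus
import HarnessLib

/-!
# An explicit differentiable `KAK` section of `U(2,1)` off `K` — III: differentiability

Topic `RepresentationTheory/KonnoKonno2007`; namespace `Literature.RepresentationTheory.KonnoKonno2007.RealDualPair`; sequel of ★ `U21KAKSection` ∕
★ `U21KAKSectionGroup`.  THEOREMS ONLY (no definition, no instance, no notation, no named fact, no `sorry`).  Cell `hodgecm-mathlib`, F0∕P3, ROAD-GLOB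
v1.1 brick «S1b» (letter A6 at `U(2,1)`): the differentiability of the explicit `KAK` section that the product rule along `s ↦ g · a_s` (brick Φ2) eats.

`secT`, `rowNorm`, `secU`, `secZ`, `secK₂`, `secK₂Inv`, `secK₁`, `secU₁` are `DifferentiableAt ℝ` at every matrix `M` with `‖r‖ ≠ 0` and `M₃₃ ≠ 0`
(both automatic at `g ∈ U(2,1) ∖ K`: ★ `rowNorm_ne_zero_iff_not_mem_range_kV`, ★ `corner_ne_zero`) — entrywise these are quotients of `ℝ`-differentiable
functions (`Real.sqrt` off `0`, `Real.arsinh`, `‖·‖` off `0`, `conj`, the entries of `t ↦ a_t` through ★ `hasDerivAt_coe_hypV`) — and the CURVE forms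
`differentiableAt_secT_comp`, `differentiableAt_secK₂_comp`, `differentiableAt_secK₂Inv_comp`, `differentiableAt_secK₁_comp` along any differentiable
matrix curve `γ` (e.g. `s ↦ ↑(g · a_s)`: `differentiableAt_coe_mul_hypV`).

(H) All statements are Mathlib's topological-vector-space `DifferentiableAt ℝ` on the carriers `Matrix (Fin 2 ⊕ Fin 1) (Fin 2 ⊕ Fin 1) ℂ` ∕ `Matrix _ _ ℂ`
∕ `ℝ` with their DEFAULT instances — no norm scope is opened (`Matrix` has no global norm at the pin; this is the convention under which ★
`hasDerivAt_coe_hypV` is stated).  The proofs run on the definitionally equal Pi types `Fin 2 ⊕ Fin 1 → Fin 2 ⊕ Fin 1 → ℂ` (Mathlib's sup-norm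
structure, through which the composition lemmas are available) and are transported by `rfl`; a consumer under `open scoped Matrix.Norms.Operator`
(or `.Elementwise`) reads the same propositions, these scoped structures inducing the default topology and module structure.

Provenance (statement shape only): [Knapp2002, VII §3 Thm. 7.39] (Cartan decomposition, real rank one), [Knapp2002, I §10 Prop. 1.87] (`a_t' = a_t H₀`).

## References
* [Knapp2002] A. W. Knapp, *Lie Groups Beyond an Introduction*, 2nd ed. (2002), I §10 Prop. 1.87, VII §3 Thm. 7.39.
-/

set_option autoImplicit false

noncomputable section

open Matrix Complex Topology Filter
open scoped ComplexConjugate MatrixGroups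
open NormedSpace

namespace Literature.RepresentationTheory.KonnoKonno2007

namespace RealDualPair

open Literature.NumberTheory.Automorphic Literature.RepresentationTheory.BorelWallach2000

/-! ## Differentiability off `K` (and off `M₃₃ = 0`) -/

section Differentiable

/-- an entry is a differentiable function of the matrix (Pi form). [cite: Knapp2002, VII §3 Thm. 7.39] -/
private theorem differentiableAt_entry (i j : Fin 2 ⊕ Fin 1) (M : Fin 2 ⊕ Fin 1 → Fin 2 ⊕ Fin 1 → ℂ) :
    DifferentiableAt ℝ (fun N : Fin 2 ⊕ Fin 1 → Fin 2 ⊕ Fin 1 → ℂ => N i j) M :=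
  differentiableAt_pi.1 (differentiableAt_pi.1 differentiableAt_id i) j

/-- `‖r‖` is differentiable where it does not vanish (Pi form). [cite: Knapp2002, VII §3 Thm. 7.39] -/
private theorem differentiableAt_rowNorm_pi (M : Fin 2 ⊕ Fin 1 → Fin 2 ⊕ Fin 1 → ℂ) (hr : rowNorm M ≠ 0) :
    DifferentiableAt ℝ (fun N : Fin 2 ⊕ Fin 1 → Fin 2 ⊕ Fin 1 → ℂ => rowNorm N) M := by
  have hs : ‖M (Sum.inr 0) (Sum.inl 0)‖ ^ 2 + ‖M (Sum.inr 0) (Sum.inl 1)‖ ^ 2 ≠ 0 := by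
    intro h0; apply hr; unfold rowNorm; rw [h0, Real.sqrt_zero]
  unfold rowNorm
  exact (((differentiableAt_entry _ _ M).norm_sq ℝ).add ((differentiableAt_entry _ _ M).norm_sq ℝ)).sqrt hs

/-- `(‖r‖ : ℂ)` is differentiable where `‖r‖ ≠ 0` (Pi form). [cite: Knapp2002, VII §3 Thm. 7.39] -/
private theorem differentiableAt_ofReal_rowNorm_pi (M : Fin 2 ⊕ Fin 1 → Fin 2 ⊕ Fin 1 → ℂ) (hr : rowNorm M ≠ 0) :
    DifferentiableAt ℝ (fun N : Fin 2 ⊕ Fin 1 → Fin 2 ⊕ Fin 1 → ℂ => (rowNorm N : ℂ)) M :=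
  Complex.ofRealCLM.differentiableAt.comp M (differentiableAt_rowNorm_pi M hr)

/-- `secT` is differentiable where `‖r‖ ≠ 0` (Pi form). [cite: Knapp2002, VII §3 Thm. 7.39] -/
private theorem differentiableAt_secT_pi (M : Fin 2 ⊕ Fin 1 → Fin 2 ⊕ Fin 1 → ℂ) (hr : rowNorm M ≠ 0) :
    DifferentiableAt ℝ (fun N : Fin 2 ⊕ Fin 1 → Fin 2 ⊕ Fin 1 → ℂ => secT N) M := by
  unfold secT
  exact (Real.differentiable_arsinh _).comp M (differentiableAt_rowNorm_pi M hr)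

/-- the conjugate of an entry is differentiable (Pi form). [cite: Knapp2002, VII §3 Thm. 7.39] -/
private theorem differentiableAt_conj_entry (i j : Fin 2 ⊕ Fin 1) (M : Fin 2 ⊕ Fin 1 → Fin 2 ⊕ Fin 1 → ℂ) :
    DifferentiableAt ℝ (fun N : Fin 2 ⊕ Fin 1 → Fin 2 ⊕ Fin 1 → ℂ => conj (N i j)) M :=
  Complex.conjCLE.differentiableAt.comp M (differentiableAt_entry i j M)

/-- `secU` is differentiable where `‖r‖ ≠ 0` (Pi form, entrywise: quotients of `ℝ`-differentiable functions by `(‖r‖ : ℂ) ≠ 0`).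
[cite: Knapp2002, VII §3 Thm. 7.39] -/
private theorem differentiableAt_secU_pi (M : Fin 2 ⊕ Fin 1 → Fin 2 ⊕ Fin 1 → ℂ) (hr : rowNorm M ≠ 0) :
    DifferentiableAt ℝ (fun N : Fin 2 ⊕ Fin 1 → Fin 2 ⊕ Fin 1 → ℂ => (secU N : Fin 2 → Fin 2 → ℂ)) M := by
  have hρ : (rowNorm M : ℂ) ≠ 0 := Complex.ofReal_ne_zero.2 hr
  have hinv : DifferentiableAt ℝ (fun N : Fin 2 ⊕ Fin 1 → Fin 2 ⊕ Fin 1 → ℂ => ((rowNorm N : ℂ))⁻¹) M :=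
    (differentiableAt_ofReal_rowNorm_pi M hr).fun_inv hρ
  refine differentiableAt_pi.2 fun a => differentiableAt_pi.2 fun a' => ?_
  fin_cases a <;> fin_cases a'
  · show DifferentiableAt ℝ (fun N : Fin 2 ⊕ Fin 1 → Fin 2 ⊕ Fin 1 → ℂ => -I * N (Sum.inr 0) (Sum.inl 0) / (rowNorm N : ℂ)) M
    simp only [div_eq_mul_inv]
    exact ((differentiableAt_const _).fun_mul (differentiableAt_entry _ _ M)).fun_mul hinv
  · show DifferentiableAt ℝ (fun N : Fin 2 ⊕ Fin 1 → Fin 2 ⊕ Fin 1 → ℂ => -I * N (Sum.inr 0) (Sum.inl 1) / (rowNorm N : ℂ)) M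
    simp only [div_eq_mul_inv]
    exact ((differentiableAt_const _).fun_mul (differentiableAt_entry _ _ M)).fun_mul hinv
  · show DifferentiableAt ℝ (fun N : Fin 2 ⊕ Fin 1 → Fin 2 ⊕ Fin 1 → ℂ => -conj (N (Sum.inr 0) (Sum.inl 1)) / (rowNorm N : ℂ)) M
    simp only [div_eq_mul_inv]
    exact (differentiableAt_conj_entry _ _ M).fun_neg.fun_mul hinv
  · show DifferentiableAt ℝ (fun N : Fin 2 ⊕ Fin 1 → Fin 2 ⊕ Fin 1 → ℂ => conj (N (Sum.inr 0) (Sum.inl 0)) / (rowNorm N : ℂ)) M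
    simp only [div_eq_mul_inv]
    exact (differentiableAt_conj_entry _ _ M).fun_mul hinv

/-- `secZ` is differentiable where `g₃₃ ≠ 0` (Pi form). [cite: Knapp2002, VII §3 Thm. 7.39] -/
private theorem differentiableAt_secZ_pi (M : Fin 2 ⊕ Fin 1 → Fin 2 ⊕ Fin 1 → ℂ) (hc : M (Sum.inr 0) (Sum.inr 0) ≠ 0) :
    DifferentiableAt ℝ (fun N : Fin 2 ⊕ Fin 1 → Fin 2 ⊕ Fin 1 → ℂ => (secZ N : Fin 1 → Fin 1 → ℂ)) M := by
  have hn : (‖M (Sum.inr 0) (Sum.inr 0)‖ : ℂ) ≠ 0 := by exact_mod_cast norm_ne_zero_iff.2 hc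
  have hinv : DifferentiableAt ℝ (fun N : Fin 2 ⊕ Fin 1 → Fin 2 ⊕ Fin 1 → ℂ => ((‖N (Sum.inr 0) (Sum.inr 0)‖ : ℂ))⁻¹) M :=
    (Complex.ofRealCLM.differentiableAt.comp M ((differentiableAt_entry _ _ M).norm ℝ hc)).fun_inv hn
  refine differentiableAt_pi.2 fun i => differentiableAt_pi.2 fun j => ?_
  fin_cases i; fin_cases j
  show DifferentiableAt ℝ (fun N : Fin 2 ⊕ Fin 1 → Fin 2 ⊕ Fin 1 → ℂ => N (Sum.inr 0) (Sum.inr 0) / (‖N (Sum.inr 0) (Sum.inr 0)‖ : ℂ)) M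
  simp only [div_eq_mul_inv]
  exact (differentiableAt_entry _ _ M).fun_mul hinv

/-- `secK₂` is differentiable where `‖r‖ ≠ 0`, `g₃₃ ≠ 0` (Pi form, block by block). [cite: Knapp2002, VII §3 Thm. 7.39] -/
private theorem differentiableAt_secK₂_pi (M : Fin 2 ⊕ Fin 1 → Fin 2 ⊕ Fin 1 → ℂ) (hr : rowNorm M ≠ 0) (hc : M (Sum.inr 0) (Sum.inr 0) ≠ 0) :
    DifferentiableAt ℝ (fun N : Fin 2 ⊕ Fin 1 → Fin 2 ⊕ Fin 1 → ℂ => (secK₂ N : Fin 2 ⊕ Fin 1 → Fin 2 ⊕ Fin 1 → ℂ)) M := by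
  have hU := differentiableAt_secU_pi M hr
  have hZ := differentiableAt_secZ_pi M hc
  refine differentiableAt_pi.2 fun i => differentiableAt_pi.2 fun j => ?_
  rcases i with a | b <;> rcases j with a' | b'
  · show DifferentiableAt ℝ (fun N : Fin 2 ⊕ Fin 1 → Fin 2 ⊕ Fin 1 → ℂ => secU N a a') M
    exact differentiableAt_pi.1 (differentiableAt_pi.1 hU a) a'
  · show DifferentiableAt ℝ (fun N : Fin 2 ⊕ Fin 1 → Fin 2 ⊕ Fin 1 → ℂ => (0 : Matrix (Fin 2) (Fin 1) ℂ) a b') M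
    exact differentiableAt_const _
  · show DifferentiableAt ℝ (fun N : Fin 2 ⊕ Fin 1 → Fin 2 ⊕ Fin 1 → ℂ => (0 : Matrix (Fin 1) (Fin 2) ℂ) b a') M
    exact differentiableAt_const _
  · show DifferentiableAt ℝ (fun N : Fin 2 ⊕ Fin 1 → Fin 2 ⊕ Fin 1 → ℂ => secZ N b b') M
    exact differentiableAt_pi.1 (differentiableAt_pi.1 hZ b) b'

/-- `secK₂Inv` is differentiable where `‖r‖ ≠ 0`, `g₃₃ ≠ 0` (Pi form). [cite: Knapp2002, VII §3 Thm. 7.39] -/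
private theorem differentiableAt_secK₂Inv_pi (M : Fin 2 ⊕ Fin 1 → Fin 2 ⊕ Fin 1 → ℂ) (hr : rowNorm M ≠ 0) (hc : M (Sum.inr 0) (Sum.inr 0) ≠ 0) :
    DifferentiableAt ℝ (fun N : Fin 2 ⊕ Fin 1 → Fin 2 ⊕ Fin 1 → ℂ => (secK₂Inv N : Fin 2 ⊕ Fin 1 → Fin 2 ⊕ Fin 1 → ℂ)) M := by
  have hU := differentiableAt_secU_pi M hr
  have hZ := differentiableAt_secZ_pi M hc
  refine differentiableAt_pi.2 fun i => differentiableAt_pi.2 fun j => ?_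
  rcases i with a | b <;> rcases j with a' | b'
  · show DifferentiableAt ℝ (fun N : Fin 2 ⊕ Fin 1 → Fin 2 ⊕ Fin 1 → ℂ => star (secU N a' a)) M
    exact Complex.conjCLE.differentiableAt.comp M (differentiableAt_pi.1 (differentiableAt_pi.1 hU a') a)
  · show DifferentiableAt ℝ (fun N : Fin 2 ⊕ Fin 1 → Fin 2 ⊕ Fin 1 → ℂ => (0 : Matrix (Fin 2) (Fin 1) ℂ) a b') M
    exact differentiableAt_const _
  · show DifferentiableAt ℝ (fun N : Fin 2 ⊕ Fin 1 → Fin 2 ⊕ Fin 1 → ℂ => (0 : Matrix (Fin 1) (Fin 2) ℂ) b a') M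
    exact differentiableAt_const _
  · show DifferentiableAt ℝ (fun N : Fin 2 ⊕ Fin 1 → Fin 2 ⊕ Fin 1 → ℂ => star (secZ N b' b)) M
    exact Complex.conjCLE.differentiableAt.comp M (differentiableAt_pi.1 (differentiableAt_pi.1 hZ b') b)

/-- the boost with a differentiable parameter: `N ↦ a_{f N}` is differentiable (Pi form; entrywise through ★ `hasDerivAt_coe_hypV`).
[cite: Knapp2002, I §10 Prop. 1.87] -/
private theorem differentiableAt_coe_hypV_comp_pi (M : Fin 2 ⊕ Fin 1 → Fin 2 ⊕ Fin 1 → ℂ) {f : (Fin 2 ⊕ Fin 1 → Fin 2 ⊕ Fin 1 → ℂ) → ℝ}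
    (hf : DifferentiableAt ℝ f M) :
    DifferentiableAt ℝ (fun N : Fin 2 ⊕ Fin 1 → Fin 2 ⊕ Fin 1 → ℂ =>
      ((((hypV (0 : Fin 2) (0 : Fin 1) (f N) : UForm (Fin 2) (Fin 1)) : GL (Fin 2 ⊕ Fin 1) ℂ) : Matrix (Fin 2 ⊕ Fin 1) (Fin 2 ⊕ Fin 1) ℂ) :
        Fin 2 ⊕ Fin 1 → Fin 2 ⊕ Fin 1 → ℂ)) M := by
  refine differentiableAt_pi.2 fun i => differentiableAt_pi.2 fun j => ?_
  have h : ∀ t : ℝ, DifferentiableAt ℝ (fun s : ℝ =>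
      (((hypV (0 : Fin 2) (0 : Fin 1) s : UForm (Fin 2) (Fin 1)) : GL (Fin 2 ⊕ Fin 1) ℂ) : Matrix (Fin 2 ⊕ Fin 1) (Fin 2 ⊕ Fin 1) ℂ) i j) t :=
    fun t => (hasDerivAt_pi.1 (hasDerivAt_pi.1 (hasDerivAt_coe_hypV (0 : Fin 2) (0 : Fin 1) t) i) j).differentiableAt
  exact (h (f M)).comp M hf

/-- a product of two matrix-valued differentiable functions is differentiable (Pi form, entrywise). [cite: Knapp2002, VII §3 Thm. 7.39] -/
private theorem differentiableAt_mul_pi (M : Fin 2 ⊕ Fin 1 → Fin 2 ⊕ Fin 1 → ℂ)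
    {A B : (Fin 2 ⊕ Fin 1 → Fin 2 ⊕ Fin 1 → ℂ) → Matrix (Fin 2 ⊕ Fin 1) (Fin 2 ⊕ Fin 1) ℂ}
    (hA : DifferentiableAt ℝ (fun N => (A N : Fin 2 ⊕ Fin 1 → Fin 2 ⊕ Fin 1 → ℂ)) M)
    (hB : DifferentiableAt ℝ (fun N => (B N : Fin 2 ⊕ Fin 1 → Fin 2 ⊕ Fin 1 → ℂ)) M) :
    DifferentiableAt ℝ (fun N => ((A N * B N : Matrix (Fin 2 ⊕ Fin 1) (Fin 2 ⊕ Fin 1) ℂ) : Fin 2 ⊕ Fin 1 → Fin 2 ⊕ Fin 1 → ℂ)) M := by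
  refine differentiableAt_pi.2 fun i => differentiableAt_pi.2 fun j => ?_
  show DifferentiableAt ℝ (fun N => ∑ k, A N i k * B N k j) M
  refine DifferentiableAt.fun_sum fun k _ => ?_
  exact (differentiableAt_pi.1 (differentiableAt_pi.1 hA i) k).fun_mul (differentiableAt_pi.1 (differentiableAt_pi.1 hB k) j)

/-- `secK₁` is differentiable where `‖r‖ ≠ 0`, `g₃₃ ≠ 0` (Pi form). [cite: Knapp2002, VII §3 Thm. 7.39] -/
private theorem differentiableAt_secK₁_pi (M : Fin 2 ⊕ Fin 1 → Fin 2 ⊕ Fin 1 → ℂ) (hr : rowNorm M ≠ 0) (hc : M (Sum.inr 0) (Sum.inr 0) ≠ 0) :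
    DifferentiableAt ℝ (fun N : Fin 2 ⊕ Fin 1 → Fin 2 ⊕ Fin 1 → ℂ => (secK₁ N : Fin 2 ⊕ Fin 1 → Fin 2 ⊕ Fin 1 → ℂ)) M := by
  unfold secK₁
  refine differentiableAt_mul_pi M (differentiableAt_mul_pi M differentiableAt_id (differentiableAt_secK₂Inv_pi M hr hc)) ?_
  exact differentiableAt_coe_hypV_comp_pi M (differentiableAt_secT_pi M hr).fun_neg

/-- `secU₁` is differentiable where `‖r‖ ≠ 0`, `g₃₃ ≠ 0` (Pi form). [cite: Knapp2002, VII §3 Thm. 7.39] -/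
private theorem differentiableAt_secU₁_pi (M : Fin 2 ⊕ Fin 1 → Fin 2 ⊕ Fin 1 → ℂ) (hr : rowNorm M ≠ 0) (hc : M (Sum.inr 0) (Sum.inr 0) ≠ 0) :
    DifferentiableAt ℝ (fun N : Fin 2 ⊕ Fin 1 → Fin 2 ⊕ Fin 1 → ℂ => (secU₁ N : Fin 2 → Fin 2 → ℂ)) M := by
  have h := differentiableAt_secK₁_pi M hr hc
  refine differentiableAt_pi.2 fun a => differentiableAt_pi.2 fun a' => ?_
  exact differentiableAt_pi.1 (differentiableAt_pi.1 h (Sum.inl a)) (Sum.inl a')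

variable (M : Matrix (Fin 2 ⊕ Fin 1) (Fin 2 ⊕ Fin 1) ℂ)

/-- **`secT` is differentiable at every matrix with `‖r‖ ≠ 0`** (so at every `g ∈ U(2,1) ∖ K`). [cite: Knapp2002, VII §3 Thm. 7.39] -/
theorem differentiableAt_secT (hr : rowNorm M ≠ 0) : DifferentiableAt ℝ secT M :=
  differentiableAt_secT_pi M hr

/-- `rowNorm` is differentiable where `‖r‖ ≠ 0`. [cite: Knapp2002, VII §3 Thm. 7.39] -/
theorem differentiableAt_rowNorm (hr : rowNorm M ≠ 0) : DifferentiableAt ℝ rowNorm M :=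
  differentiableAt_rowNorm_pi M hr

/-- `secU` is differentiable where `‖r‖ ≠ 0`. [cite: Knapp2002, VII §3 Thm. 7.39] -/
theorem differentiableAt_secU (hr : rowNorm M ≠ 0) : DifferentiableAt ℝ secU M :=
  differentiableAt_secU_pi M hr

/-- `secZ` is differentiable where `g₃₃ ≠ 0`. [cite: Knapp2002, VII §3 Thm. 7.39] -/
theorem differentiableAt_secZ (hc : M (Sum.inr 0) (Sum.inr 0) ≠ 0) : DifferentiableAt ℝ secZ M :=
  differentiableAt_secZ_pi M hc

/-- **`secK₂` is differentiable at every matrix with `‖r‖ ≠ 0` and `g₃₃ ≠ 0`** (so at every `g ∈ U(2,1) ∖ K`). [cite: Knapp2002, VII §3 Thm. 7.39] -/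
theorem differentiableAt_secK₂ (hr : rowNorm M ≠ 0) (hc : M (Sum.inr 0) (Sum.inr 0) ≠ 0) : DifferentiableAt ℝ secK₂ M :=
  differentiableAt_secK₂_pi M hr hc

/-- `secK₂Inv` is differentiable at every matrix with `‖r‖ ≠ 0` and `g₃₃ ≠ 0`. [cite: Knapp2002, VII §3 Thm. 7.39] -/
theorem differentiableAt_secK₂Inv (hr : rowNorm M ≠ 0) (hc : M (Sum.inr 0) (Sum.inr 0) ≠ 0) : DifferentiableAt ℝ secK₂Inv M :=
  differentiableAt_secK₂Inv_pi M hr hc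

/-- **`secK₁` is differentiable at every matrix with `‖r‖ ≠ 0` and `g₃₃ ≠ 0`** (so at every `g ∈ U(2,1) ∖ K`). [cite: Knapp2002, VII §3 Thm. 7.39] -/
theorem differentiableAt_secK₁ (hr : rowNorm M ≠ 0) (hc : M (Sum.inr 0) (Sum.inr 0) ≠ 0) : DifferentiableAt ℝ secK₁ M :=
  differentiableAt_secK₁_pi M hr hc

/-- `secU₁` is differentiable at every matrix with `‖r‖ ≠ 0` and `g₃₃ ≠ 0`. [cite: Knapp2002, VII §3 Thm. 7.39] -/
theorem differentiableAt_secU₁ (hr : rowNorm M ≠ 0) (hc : M (Sum.inr 0) (Sum.inr 0) ≠ 0) : DifferentiableAt ℝ secU₁ M :=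
  differentiableAt_secU₁_pi M hr hc

/-! ### along differentiable matrix curves (the form consumed by product rules in `s`) -/

/-- transport of differentiability along a matrix curve, entrywise (the composite lemma `DifferentiableAt.comp` wants normed carriers, which the
entries have). [cite: Knapp2002, VII §3 Thm. 7.39] -/
private theorem differentiableAt_comp_of_pi {F : (Fin 2 ⊕ Fin 1 → Fin 2 ⊕ Fin 1 → ℂ) → Matrix (Fin 2 ⊕ Fin 1) (Fin 2 ⊕ Fin 1) ℂ}
    {γ : ℝ → Matrix (Fin 2 ⊕ Fin 1) (Fin 2 ⊕ Fin 1) ℂ} {s₀ : ℝ}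
    (hF : DifferentiableAt ℝ (fun N : Fin 2 ⊕ Fin 1 → Fin 2 ⊕ Fin 1 → ℂ => (F N : Fin 2 ⊕ Fin 1 → Fin 2 ⊕ Fin 1 → ℂ)) (γ s₀))
    (hγ : DifferentiableAt ℝ γ s₀) :
    DifferentiableAt ℝ (fun s => F (γ s)) s₀ := by
  let γ' : ℝ → (Fin 2 ⊕ Fin 1 → Fin 2 ⊕ Fin 1 → ℂ) := fun s => γ s
  have hγ' : DifferentiableAt ℝ γ' s₀ := hγ
  refine differentiableAt_pi.2 fun i => differentiableAt_pi.2 fun j => ?_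
  exact (differentiableAt_pi.1 (differentiableAt_pi.1 hF i) j).comp s₀ hγ'

variable {γ : ℝ → Matrix (Fin 2 ⊕ Fin 1) (Fin 2 ⊕ Fin 1) ℂ} {s₀ : ℝ}

/-- `s ↦ secT (γ s)` is differentiable at `s₀` if `γ` is and `‖r(γ s₀)‖ ≠ 0`. [cite: Knapp2002, VII §3 Thm. 7.39] -/
theorem differentiableAt_secT_comp (hγ : DifferentiableAt ℝ γ s₀) (hr : rowNorm (γ s₀) ≠ 0) :
    DifferentiableAt ℝ (fun s => secT (γ s)) s₀ := by
  let γ' : ℝ → (Fin 2 ⊕ Fin 1 → Fin 2 ⊕ Fin 1 → ℂ) := fun s => γ s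
  have hγ' : DifferentiableAt ℝ γ' s₀ := hγ
  exact (differentiableAt_secT_pi _ hr).comp s₀ hγ'

/-- `s ↦ secK₂ (γ s)` is differentiable at `s₀` if `γ` is and `‖r(γ s₀)‖ ≠ 0`, `(γ s₀)₃₃ ≠ 0`. [cite: Knapp2002, VII §3 Thm. 7.39] -/
theorem differentiableAt_secK₂_comp (hγ : DifferentiableAt ℝ γ s₀) (hr : rowNorm (γ s₀) ≠ 0) (hc : γ s₀ (Sum.inr 0) (Sum.inr 0) ≠ 0) :
    DifferentiableAt ℝ (fun s => secK₂ (γ s)) s₀ :=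
  differentiableAt_comp_of_pi (differentiableAt_secK₂_pi _ hr hc) hγ

/-- `s ↦ secK₂Inv (γ s)` is differentiable at `s₀` if `γ` is and `‖r(γ s₀)‖ ≠ 0`, `(γ s₀)₃₃ ≠ 0`. [cite: Knapp2002, VII §3 Thm. 7.39] -/
theorem differentiableAt_secK₂Inv_comp (hγ : DifferentiableAt ℝ γ s₀) (hr : rowNorm (γ s₀) ≠ 0) (hc : γ s₀ (Sum.inr 0) (Sum.inr 0) ≠ 0) :
    DifferentiableAt ℝ (fun s => secK₂Inv (γ s)) s₀ :=
  differentiableAt_comp_of_pi (differentiableAt_secK₂Inv_pi _ hr hc) hγ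

/-- `s ↦ secK₁ (γ s)` is differentiable at `s₀` if `γ` is and `‖r(γ s₀)‖ ≠ 0`, `(γ s₀)₃₃ ≠ 0`. [cite: Knapp2002, VII §3 Thm. 7.39] -/
theorem differentiableAt_secK₁_comp (hγ : DifferentiableAt ℝ γ s₀) (hr : rowNorm (γ s₀) ≠ 0) (hc : γ s₀ (Sum.inr 0) (Sum.inr 0) ≠ 0) :
    DifferentiableAt ℝ (fun s => secK₁ (γ s)) s₀ :=
  differentiableAt_comp_of_pi (differentiableAt_secK₁_pi _ hr hc) hγ

/-- the model curve `s ↦ g · a_s` (matrix form) is differentiable everywhere (★ `hasDerivAt_coe_hypV`). [cite: Knapp2002, I §10 Prop. 1.87] -/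
theorem differentiableAt_coe_mul_hypV (g : UForm (Fin 2) (Fin 1)) (s₀ : ℝ) :
    DifferentiableAt ℝ (fun s : ℝ =>
      (((g * hypV (0 : Fin 2) (0 : Fin 1) s : UForm (Fin 2) (Fin 1)) : GL (Fin 2 ⊕ Fin 1) ℂ) : Matrix (Fin 2 ⊕ Fin 1) (Fin 2 ⊕ Fin 1) ℂ)) s₀ := by
  have hD : ∀ (k j : Fin 2 ⊕ Fin 1) (t : ℝ), DifferentiableAt ℝ (fun s : ℝ =>
      (((hypV (0 : Fin 2) (0 : Fin 1) s : UForm (Fin 2) (Fin 1)) : GL (Fin 2 ⊕ Fin 1) ℂ) : Matrix (Fin 2 ⊕ Fin 1) (Fin 2 ⊕ Fin 1) ℂ) k j) t :=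
    fun k j t => (hasDerivAt_pi.1 (hasDerivAt_pi.1 (hasDerivAt_coe_hypV (0 : Fin 2) (0 : Fin 1) t) k) j).differentiableAt
  refine differentiableAt_pi.2 fun i => differentiableAt_pi.2 fun j => ?_
  simp only [UForm.coe_mul, Matrix.mul_apply]
  exact DifferentiableAt.fun_sum fun k _ => (differentiableAt_const _).fun_mul (hD k j s₀)

end Differentiable

/-! ## ED. 2 (append-only): continuity, openness of the good set, eventual and `HasDerivAt` forms along curves

What the consumer of a section ALONG A CURVE `s ↦ γ s` (e.g. `γ s = ↑(g · a_s)`) needs besides differentiability at `s₀`: the good set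
`{‖r‖ ≠ 0} ∩ {M₃₃ ≠ 0}` is OPEN, so the hypotheses at `s₀` propagate to a neighbourhood (`eventually_rowNorm_ne_zero`, `eventually_corner_ne_zero`),
the section identity holds EVENTUALLY along `s ↦ ↑(g · a_s)` (`eventually_coe_mul_hypV_eq_sec`), and the `HasDerivAt _ (deriv _ s₀) s₀` forms of §6. -/

section AlongCurves

/-- an entry is a continuous function of the matrix. [cite: Knapp2002, VII §3 Thm. 7.39] -/
theorem continuous_entry (i j : Fin 2 ⊕ Fin 1) : Continuous fun M : Matrix (Fin 2 ⊕ Fin 1) (Fin 2 ⊕ Fin 1) ℂ => M i j :=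
  (continuous_apply j).comp (continuous_apply i)

/-- `rowNorm` is continuous (everywhere). [cite: Knapp2002, VII §3 Thm. 7.39] -/
theorem continuous_rowNorm : Continuous rowNorm := by
  unfold rowNorm
  exact (((continuous_entry _ _).norm.pow 2).add ((continuous_entry _ _).norm.pow 2)).sqrt

/-- `secT` is continuous (everywhere). [cite: Knapp2002, VII §3 Thm. 7.39] -/
theorem continuous_secT : Continuous secT :=
  Real.continuous_arsinh.comp continuous_rowNorm

/-- the good set `{‖r‖ ≠ 0}` is open. [cite: Knapp2002, VII §3 Thm. 7.39] -/
theorem isOpen_setOf_rowNorm_ne_zero : IsOpen {M : Matrix (Fin 2 ⊕ Fin 1) (Fin 2 ⊕ Fin 1) ℂ | rowNorm M ≠ 0} :=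
  isOpen_ne_fun continuous_rowNorm continuous_const

/-- the good set `{M₃₃ ≠ 0}` is open. [cite: Knapp2002, VII §3 Thm. 7.39] -/
theorem isOpen_setOf_corner_ne_zero : IsOpen {M : Matrix (Fin 2 ⊕ Fin 1) (Fin 2 ⊕ Fin 1) ℂ | M (Sum.inr 0) (Sum.inr 0) ≠ 0} :=
  isOpen_ne_fun (continuous_entry _ _) continuous_const

variable {γ : ℝ → Matrix (Fin 2 ⊕ Fin 1) (Fin 2 ⊕ Fin 1) ℂ} {s₀ : ℝ}

/-- `‖r‖ ≠ 0` at `γ s₀` propagates to a neighbourhood of `s₀` along a curve continuous at `s₀`. [cite: Knapp2002, VII §3 Thm. 7.39] -/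
theorem eventually_rowNorm_ne_zero (hγ : ContinuousAt γ s₀) (hr : rowNorm (γ s₀) ≠ 0) : ∀ᶠ s in 𝓝 s₀, rowNorm (γ s) ≠ 0 :=
  hγ.preimage_mem_nhds (isOpen_setOf_rowNorm_ne_zero.mem_nhds hr)

/-- `M₃₃ ≠ 0` at `γ s₀` propagates to a neighbourhood of `s₀` along a curve continuous at `s₀`. [cite: Knapp2002, VII §3 Thm. 7.39] -/
theorem eventually_corner_ne_zero (hγ : ContinuousAt γ s₀) (hc : γ s₀ (Sum.inr 0) (Sum.inr 0) ≠ 0) :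
    ∀ᶠ s in 𝓝 s₀, γ s (Sum.inr 0) (Sum.inr 0) ≠ 0 :=
  hγ.preimage_mem_nhds (isOpen_setOf_corner_ne_zero.mem_nhds hc)

/-- the model curve `s ↦ ↑(g · a_s)` is continuous (★ `continuous_hypV`). [cite: Knapp2002, I §10 Prop. 1.87] -/
theorem continuous_coe_mul_hypV (g : UForm (Fin 2) (Fin 1)) :
    Continuous fun s : ℝ =>
      (((g * hypV (0 : Fin 2) (0 : Fin 1) s : UForm (Fin 2) (Fin 1)) : GL (Fin 2 ⊕ Fin 1) ℂ) : Matrix (Fin 2 ⊕ Fin 1) (Fin 2 ⊕ Fin 1) ℂ) :=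
  (Units.continuous_val.comp continuous_subtype_val).comp (continuous_const.mul (continuous_hypV (0 : Fin 2) (0 : Fin 1)))

/-- **the section identity holds EVENTUALLY along `s ↦ g · a_s` near a good point**: if `g · a_{s₀} ∉ K` then for `s` near `s₀`,
`↑(g a_s) = secK₁ ↑(g a_s) · ↑(a_{secT ↑(g a_s)}) · secK₂ ↑(g a_s)`. [cite: Knapp2002, VII §3 Thm. 7.39] -/
theorem eventually_coe_mul_hypV_eq_sec (g : UForm (Fin 2) (Fin 1))
    (hr : rowNorm (((g * hypV (0 : Fin 2) (0 : Fin 1) s₀ : UForm (Fin 2) (Fin 1)) : GL (Fin 2 ⊕ Fin 1) ℂ) : Matrix (Fin 2 ⊕ Fin 1) (Fin 2 ⊕ Fin 1) ℂ) ≠ 0) :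
    ∀ᶠ s in 𝓝 s₀,
      (((g * hypV (0 : Fin 2) (0 : Fin 1) s : UForm (Fin 2) (Fin 1)) : GL (Fin 2 ⊕ Fin 1) ℂ) : Matrix (Fin 2 ⊕ Fin 1) (Fin 2 ⊕ Fin 1) ℂ) =
        secK₁ (((g * hypV (0 : Fin 2) (0 : Fin 1) s : UForm (Fin 2) (Fin 1)) : GL (Fin 2 ⊕ Fin 1) ℂ) : Matrix (Fin 2 ⊕ Fin 1) (Fin 2 ⊕ Fin 1) ℂ) *
          (((hypV (0 : Fin 2) (0 : Fin 1)
              (secT (((g * hypV (0 : Fin 2) (0 : Fin 1) s : UForm (Fin 2) (Fin 1)) : GL (Fin 2 ⊕ Fin 1) ℂ) : Matrix (Fin 2 ⊕ Fin 1) (Fin 2 ⊕ Fin 1) ℂ)) :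
              UForm (Fin 2) (Fin 1)) : GL (Fin 2 ⊕ Fin 1) ℂ) : Matrix (Fin 2 ⊕ Fin 1) (Fin 2 ⊕ Fin 1) ℂ) *
          secK₂ (((g * hypV (0 : Fin 2) (0 : Fin 1) s : UForm (Fin 2) (Fin 1)) : GL (Fin 2 ⊕ Fin 1) ℂ) : Matrix (Fin 2 ⊕ Fin 1) (Fin 2 ⊕ Fin 1) ℂ) := by
  filter_upwards [eventually_rowNorm_ne_zero (continuous_coe_mul_hypV g).continuousAt hr] with s hs
  exact coe_eq_secK₁_mul_hypV_mul_secK₂ (g * hypV (0 : Fin 2) (0 : Fin 1) s) hs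

/-- `HasDerivAt` form of `differentiableAt_secT_comp`. [cite: Knapp2002, VII §3 Thm. 7.39] -/
theorem hasDerivAt_secT_comp (hγ : DifferentiableAt ℝ γ s₀) (hr : rowNorm (γ s₀) ≠ 0) :
    HasDerivAt (fun s => secT (γ s)) (deriv (fun s => secT (γ s)) s₀) s₀ :=
  (differentiableAt_secT_comp hγ hr).hasDerivAt

/-- `HasDerivAt` form for matrix-valued composites (through the defeq Pi type). [cite: Knapp2002, VII §3 Thm. 7.39] -/
private theorem hasDerivAt_deriv_of_differentiableAt_pi {F : ℝ → Matrix (Fin 2 ⊕ Fin 1) (Fin 2 ⊕ Fin 1) ℂ} (h : DifferentiableAt ℝ F s₀) :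
    HasDerivAt F (deriv F s₀) s₀ := by
  let F' : ℝ → (Fin 2 ⊕ Fin 1 → Fin 2 ⊕ Fin 1 → ℂ) := fun s => F s
  have h' : DifferentiableAt ℝ F' s₀ := h
  exact h'.hasDerivAt

/-- `HasDerivAt` form of `differentiableAt_secK₁_comp`. [cite: Knapp2002, VII §3 Thm. 7.39] -/
theorem hasDerivAt_secK₁_comp (hγ : DifferentiableAt ℝ γ s₀) (hr : rowNorm (γ s₀) ≠ 0) (hc : γ s₀ (Sum.inr 0) (Sum.inr 0) ≠ 0) :
    HasDerivAt (fun s => secK₁ (γ s)) (deriv (fun s => secK₁ (γ s)) s₀) s₀ :=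
  hasDerivAt_deriv_of_differentiableAt_pi (differentiableAt_secK₁_comp hγ hr hc)

/-- `HasDerivAt` form of `differentiableAt_secK₂_comp`. [cite: Knapp2002, VII §3 Thm. 7.39] -/
theorem hasDerivAt_secK₂_comp (hγ : DifferentiableAt ℝ γ s₀) (hr : rowNorm (γ s₀) ≠ 0) (hc : γ s₀ (Sum.inr 0) (Sum.inr 0) ≠ 0) :
    HasDerivAt (fun s => secK₂ (γ s)) (deriv (fun s => secK₂ (γ s)) s₀) s₀ :=
  hasDerivAt_deriv_of_differentiableAt_pi (differentiableAt_secK₂_comp hγ hr hc)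

/-- `HasDerivAt` form of `differentiableAt_secK₂Inv_comp`. [cite: Knapp2002, VII §3 Thm. 7.39] -/
theorem hasDerivAt_secK₂Inv_comp (hγ : DifferentiableAt ℝ γ s₀) (hr : rowNorm (γ s₀) ≠ 0) (hc : γ s₀ (Sum.inr 0) (Sum.inr 0) ≠ 0) :
    HasDerivAt (fun s => secK₂Inv (γ s)) (deriv (fun s => secK₂Inv (γ s)) s₀) s₀ :=
  hasDerivAt_deriv_of_differentiableAt_pi (differentiableAt_secK₂Inv_comp hγ hr hc)

end AlongCurves

end RealDualPair

end Literature.RepresentationTheory.KonnoKonno2007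

end
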